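import Summits.ValiantsHypothesis.ValiantsHypothesis.Theorems.BinomialElusivePeelingLemmaWindowCalculus

/-!
# Few-slots lemma along one arm (all-X designs against `BinomialElusive.PeelingLemma`)

Helper for the crux stmt-ValiantsHypothesis-7391 (negative lane; `Cruxes/PeelingLemma/DETERMINISTIC-ALLX.md`
§3, the mid-arm case of the local lemma [E]; = the refuter's few-slots lemma F1/F3 for path windows,
`Cruxes/PeelingLemma/REFEREE-ref1.md` §4).  Along an arm with injective birth sequence `f` and
window vectors `win f q t`:

* `win_born_add_win_born_succ` — the DUAL pair identity: the letters `f τ` and `f (τ+1)` together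
  have coefficient `[t = τ] + [t = τ + 2q + 1]` in `win f q t`; hence (`coef_add_coef_succ`) the
  coefficients of consecutive letters in a charge combination satisfy
  `coef τ + coef (τ+1) = c τ + c (τ + 2q + 1)` — all slot computations become algebra.
* `four_slots_of_potential` — ONE-SIDED FEW-SLOTS LEMMA: if the charges `c` on the arm are the
  increments of a finitely supported potential `D` (this is the case when the other alphabet's
  charges vanish on the arm: `D = u - u'` edge by edge, BALANCE) whose `ℓ₁`-norm is `< 4q` (the cost
  of the relation is `< 4q`), and `c ≠ 0`, then at least FOUR distinct letters carry a nonzero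
  coefficient.  (Two edge charges at distance `2q+1` telescope to two letters — but their potential
  is `2v` on `2q` consecutive edges, cost `≥ 4q`.)
* `two_slots` — any nonzero charge configuration has two distinct slots (top and bottom letters);
  so a piece charged in BOTH alphabets has `≥ 2 + 2` slots.
Pure combinatorics over the window calculus; no Theses import.
-/

namespace Summit.ValiantsHypothesis.ValiantsHypothesis.Theorems.PeelingLemmaWindow

-- summit = sub-problem name (single-conjunct summit, D-0017 layout), so the namespace repeats it
set_option linter.dupNamespace false

open scoped BigOperators
open Finset

variable {Λ : Type*} [DecidableEq Λ]

/-- **Dual pair identity.**  In the window vector at `t`, the consecutive letters `f τ`, `f (τ+1)`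
have total coefficient `[t = τ] + [t = τ + 2q + 1]`: inside a common window their signs cancel. -/
theorem win_born_add_win_born_succ {f : ℤ → Λ} (hf : Function.Injective f) (q : ℕ) (t τ : ℤ) :
    win f q t (f τ) + win f q t (f (τ + 1)) =
      (if t = τ then 1 else 0) + (if t = τ + 2 * q + 1 then 1 else 0) := by
  rw [win_apply_born hf, win_apply_born hf]
  by_cases h1 : t = τ
  · subst h1
    have h2 : ¬ (t + 1 ≤ t ∧ t ≤ t + 1 + 2 * q) := by omega
    have h3 : ¬ (t = t + 2 * q + 1) := by omega
    rw [if_pos ⟨le_rfl, by omega⟩, if_neg h2, if_pos rfl, if_neg h3, sub_self]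
    simp
  by_cases h2 : t = τ + 2 * q + 1
  · have h3 : ¬ (τ ≤ t ∧ t ≤ τ + 2 * q) := by omega
    rw [if_neg h3, if_pos ⟨by omega, by omega⟩, if_neg h1, if_pos h2]
    have : (t - (τ + 1)).toNat = 2 * q := by omega
    rw [this, Even.neg_pow (even_two_mul q), one_pow]
  rw [if_neg h1, if_neg h2, add_zero]
  by_cases h3 : τ ≤ t ∧ t ≤ τ + 2 * q
  · have h4 : τ + 1 ≤ t ∧ t ≤ τ + 1 + 2 * q := ⟨by omega, by omega⟩
    rw [if_pos h3, if_pos h4]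
    have : (t - τ).toNat = (t - (τ + 1)).toNat + 1 := by omega
    rw [this, pow_succ]; ring
  · have h4 : ¬ (τ + 1 ≤ t ∧ t ≤ τ + 1 + 2 * q) := by omega
    rw [if_neg h3, if_neg h4, add_zero]

/-- **Coefficient recursion.**  For a charge combination over `S`,
`coef τ + coef (τ+1) = c τ · [τ ∈ S] + c (τ+2q+1) · [τ+2q+1 ∈ S]`. -/
theorem coef_add_coef_succ {f : ℤ → Λ} (hf : Function.Injective f) (q : ℕ) (S : Finset ℤ)
    (c : ℤ → ℤ) (τ : ℤ) :
    ∑ t ∈ S, c t * win f q t (f τ) + ∑ t ∈ S, c t * win f q t (f (τ + 1)) =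
      (if τ ∈ S then c τ else 0) + (if τ + 2 * q + 1 ∈ S then c (τ + 2 * q + 1) else 0) := by
  rw [← Finset.sum_add_distrib]
  have : ∀ t ∈ S, c t * win f q t (f τ) + c t * win f q t (f (τ + 1)) =
      (if τ = t then c t else 0) + (if τ + 2 * q + 1 = t then c t else 0) := by
    intro t _
    have e1 : c t * (if t = τ then (1 : ℤ) else 0) = if τ = t then c t else 0 := by
      by_cases h : t = τ
      · subst h; simp
      · have h' : ¬ τ = t := fun e => h e.symm
        simp [h, h']
    have e2 : c t * (if t = τ + 2 * q + 1 then (1 : ℤ) else 0) =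
        if τ + 2 * q + 1 = t then c t else 0 := by
      by_cases h : t = τ + 2 * q + 1
      · subst h; simp
      · have h' : ¬ τ + 2 * q + 1 = t := fun e => h e.symm
        simp [h, h']
    rw [← mul_add, win_born_add_win_born_succ hf, mul_add, e1, e2]
  rw [Finset.sum_congr rfl this, Finset.sum_add_distrib, Finset.sum_ite_eq, Finset.sum_ite_eq]

/-- **Two slots.**  A nonzero charge configuration on `[t₀, t₁]` with `c t₀ ≠ 0 ≠ c t₁` has the two
distinct slots `f t₁` (top) and `f (t₀ - 2q)` (bottom), provided `q ≥ 1` or `t₀ < t₁`. -/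
theorem two_slots {f : ℤ → Λ} (hf : Function.Injective f) (q : ℕ) (c : ℤ → ℤ) (t₀ t₁ : ℤ)
    (h01 : t₀ ≤ t₁) (hq : t₀ - 2 * q ≠ t₁) (hc0 : c t₀ ≠ 0) (hc1 : c t₁ ≠ 0) :
    t₁ ≠ t₀ - 2 * q ∧
    (∑ t ∈ Finset.Icc t₀ t₁, c t * win f q t (f t₁) ≠ 0) ∧
    (∑ t ∈ Finset.Icc t₀ t₁, c t * win f q t (f (t₀ - 2 * q)) ≠ 0) := by
  refine ⟨fun h => hq h.symm, ?_, ?_⟩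
  · rw [charge_sum_apply_top hf q _ c (Finset.mem_Icc.mpr ⟨h01, le_rfl⟩)
      (fun t ht hlt => absurd (Finset.mem_Icc.mp ht).2 (not_le.mpr hlt))]
    exact hc1
  · rw [charge_sum_apply_bottom hf q _ c (Finset.mem_Icc.mpr ⟨le_rfl, h01⟩)
      (fun t ht hlt => absurd (Finset.mem_Icc.mp ht).1 (not_le.mpr hlt))]
    exact hc0

/-- **One-sided few-slots lemma** (mid-arm case of the gadget local lemma).  Let the charges `c`
along an arm with injective birth sequence `f` be supported in `[t₀, t₁]` with `c t₀ ≠ 0 ≠ c t₁`,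
and let them be the increments of a potential `D` (`D (k+1) - D k = c k`) vanishing left of `t₀` and
right of `t₁` whose `ℓ₁`-norm on `[t₀, t₁ + 1]` is `< 4q` (`q ≥ 2`).  Then at least four distinct
positions `τ` carry a nonzero coefficient `Σ_t c t · win f q t (f τ)`; by injectivity of `f` these
are four distinct support letters. -/
theorem four_slots_of_potential {f : ℤ → Λ} (hf : Function.Injective f) (q : ℕ) (hq : 2 ≤ q)
    (c D : ℤ → ℤ) (t₀ t₁ : ℤ) (h01 : t₀ ≤ t₁) (hc0 : c t₀ ≠ 0) (hc1 : c t₁ ≠ 0)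
    (hcout : ∀ t, t < t₀ ∨ t₁ < t → c t = 0) (hD : ∀ k, D (k + 1) - D k = c k)
    (hD0 : ∀ k, k ≤ t₀ → D k = 0) (hD1 : ∀ k, t₁ < k → D k = 0)
    (hcost : ∑ k ∈ Finset.Icc t₀ (t₁ + 1), |D k| < 4 * q) :
    ∃ T : Finset ℤ, T.card = 4 ∧ ∀ τ ∈ T, ∑ t ∈ Finset.Icc t₀ t₁, c t * win f q t (f τ) ≠ 0 := by
  -- notation
  set S := Finset.Icc t₀ t₁ with hS
  let coef : ℤ → ℤ := fun τ => ∑ t ∈ S, c t * win f q t (f τ)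
  have hmemS : ∀ t, t ∈ S ↔ t₀ ≤ t ∧ t ≤ t₁ := fun t => Finset.mem_Icc
  -- the coefficient recursion specialised to S = [t₀, t₁]
  have hrec : ∀ τ, coef τ + coef (τ + 1) =
      (if t₀ ≤ τ ∧ τ ≤ t₁ then c τ else 0) +
        (if t₀ ≤ τ + 2 * q + 1 ∧ τ + 2 * q + 1 ≤ t₁ then c (τ + 2 * q + 1) else 0) := by
    intro τ
    have h := coef_add_coef_succ hf q S c τ
    simp only [hmemS] at h
    exact h
  -- span ≥ 1: a single charge cannot be the increment of a finitely supported potential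
  have hlt : t₀ < t₁ := by
    rcases lt_or_eq_of_le h01 with h | h
    · exact h
    · exfalso
      have h1 := hD t₀
      rw [hD0 t₀ le_rfl, hD1 (t₀ + 1) (by rw [← h]; omega)] at h1
      exact hc0 (by linarith)
  -- top and bottom slots
  obtain ⟨-, htop, hbot⟩ := two_slots hf q c t₀ t₁ h01 (by omega) hc0 hc1
  have htop' : coef t₁ ≠ 0 := htop
  have hbot' : coef (t₀ - 2 * q) ≠ 0 := hbot
  have hctop : coef t₁ = c t₁ :=
    charge_sum_apply_top hf q _ c (Finset.mem_Icc.mpr ⟨h01, le_rfl⟩)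
      (fun t ht hlt => absurd (Finset.mem_Icc.mp ht).2 (not_le.mpr hlt))
  have hcbot : coef (t₀ - 2 * q) = c t₀ :=
    charge_sum_apply_bottom hf q _ c (Finset.mem_Icc.mpr ⟨le_rfl, h01⟩)
      (fun t ht hlt => absurd (Finset.mem_Icc.mp ht).1 (not_le.mpr hlt))
  -- the next-to-bottom and next-to-top coefficients
  have hb1 : coef (t₀ - 2 * q + 1) = c (t₀ + 1) - c t₀ := by
    have h := hrec (t₀ - 2 * q)
    rw [show t₀ - 2 * q + 2 * q + 1 = t₀ + 1 by ring, if_neg (by omega)] at h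
    by_cases h' : t₀ + 1 ≤ t₁
    · rw [if_pos ⟨by omega, h'⟩] at h; rw [hcbot] at h; linarith
    · omega
  have ht1 : coef (t₁ - 1) = c (t₁ - 1) - c t₁ := by
    have h := hrec (t₁ - 1)
    rw [show t₁ - 1 + 1 = t₁ by ring, if_pos ⟨by omega, by omega⟩, if_neg (by omega),
      hctop] at h
    linarith
  -- BOTTOM SIDE: either a second bottom slot, or the cost is ≥ 4q
  have hbottom : ∃ τ, t₀ - 2 * q + 1 ≤ τ ∧ τ ≤ t₀ ∧ coef τ ≠ 0 ∧
      (τ = t₀ → t₀ + 2 * q ≤ t₁ ∧ ∀ i : ℕ, 2 ≤ i → i < 2 * q → c (t₀ + i) = 0) := by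
    by_cases hb : c (t₀ + 1) = c t₀
    · -- edge-charge start: look for the next charge within reach
      by_cases hk : ∃ k : ℕ, 2 ≤ k ∧ k ≤ 2 * q ∧ c (t₀ + k) ≠ 0
      · -- minimal such k
        classical
        let k := Nat.find hk
        obtain ⟨hk2, hk2q, hck⟩ := Nat.find_spec hk
        have hmin : ∀ i : ℕ, 2 ≤ i → i < k → c (t₀ + i) = 0 := by
          intro i hi hik
          by_contra hci
          exact Nat.find_min hk hik ⟨hi, by omega, hci⟩
        -- by induction the coefficients at t₀ - 2q + i vanish for 1 ≤ i < k
        have hzero : ∀ i : ℕ, 1 ≤ i → i < k → coef (t₀ - 2 * q + i) = 0 := by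
          intro i hi hik
          induction i with
          | zero => omega
          | succ i ih =>
            rcases Nat.eq_zero_or_pos i with h0 | h0
            · subst h0; simp only [zero_add, Nat.cast_one]; rw [hb1, hb, sub_self]
            · have hprev := ih h0 (by omega)
              have h := hrec (t₀ - 2 * q + i)
              rw [hprev, zero_add, if_neg (by omega), zero_add,
                show t₀ - 2 * q + (i : ℤ) + 2 * q + 1 = t₀ + ((i + 1 : ℕ) : ℤ) by push_cast; ring] at h
              rw [show t₀ - 2 * q + (i : ℤ) + 1 = t₀ - 2 * q + ((i + 1 : ℕ) : ℤ) by push_cast; ring] at h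
              rw [h]
              by_cases hr : t₀ ≤ t₀ + ((i + 1 : ℕ) : ℤ) ∧ t₀ + ((i + 1 : ℕ) : ℤ) ≤ t₁
              · rw [if_pos hr]; exact hmin (i + 1) (by omega) hik
              · rw [if_neg hr]
        have hkt : t₀ + (k : ℤ) ≤ t₁ := by
          by_contra hh
          exact hck (hcout _ (Or.inr (by omega)))
        refine ⟨t₀ - 2 * q + k, by omega, by omega, ?_, fun hτ => ⟨by omega, fun i hi hi2 => ?_⟩⟩
        swap
        · exact hmin i hi (by omega)
        have h := hrec (t₀ - 2 * q + ((k - 1 : ℕ) : ℤ))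
        have hkm1 : coef (t₀ - 2 * q + ((k - 1 : ℕ) : ℤ)) = 0 := hzero (k - 1) (by omega) (by omega)
        rw [hkm1, zero_add, if_neg (by omega), zero_add,
          show t₀ - 2 * q + ((k - 1 : ℕ) : ℤ) + 1 = t₀ - 2 * q + (k : ℤ) by omega,
          show t₀ - 2 * q + ((k - 1 : ℕ) : ℤ) + 2 * q + 1 = t₀ + (k : ℤ) by omega] at h
        rw [h]
        rw [if_pos ⟨by omega, hkt⟩]; exact hck
      · -- no charge within reach: the potential is 2v on 2q consecutive edges
        exfalso
        push Not at hk
        have hv : c t₀ ≠ 0 := hc0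
        -- t₁ ≥ t₀ + 2q + 1
        have ht1far : t₀ + 2 * q + 1 ≤ t₁ := by
          by_contra hh
          have hspan : t₁ - t₀ < 2 * q + 1 := by omega
          rcases lt_or_ge (t₁ - t₀) 2 with hs | hs
          · -- span 1: c = (v, v), but Σ c = 0
            have heq : t₁ = t₀ + 1 := by omega
            have h1 := hD t₀; have h2 := hD (t₀ + 1)
            rw [hD0 t₀ le_rfl] at h1
            rw [hD1 (t₀ + 1 + 1) (by omega)] at h2
            rw [heq] at hc1
            have : c t₀ + c (t₀ + 1) = 0 := by linarith
            rw [hb] at this; exact hv (by linarith)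
          · have := hk (t₁ - t₀).toNat (by omega) (by omega)
            rw [show t₀ + ((t₁ - t₀).toNat : ℤ) = t₁ by omega] at this
            exact hc1 this
        -- D k = 2 v on [t₀ + 2, t₀ + 2q + 1]
        have hD1v : D (t₀ + 1) = c t₀ := by have := hD t₀; rw [hD0 t₀ le_rfl] at this; linarith
        have hD2v : ∀ i : ℕ, i ≤ 2 * q - 1 → D (t₀ + 2 + i) = 2 * c t₀ := by
          intro i hi
          induction i with
          | zero =>
            have := hD (t₀ + 1)
            rw [show t₀ + 1 + 1 = t₀ + 2 + ((0 : ℕ) : ℤ) by push_cast; ring, hD1v, hb] at this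
            linarith
          | succ i ih =>
            have hprev := ih (by omega)
            have := hD (t₀ + 2 + i)
            rw [hprev, show t₀ + 2 + (i : ℤ) + 1 = t₀ + 2 + ((i + 1 : ℕ) : ℤ) by push_cast; ring,
              show t₀ + 2 + (i : ℤ) = t₀ + ((i + 2 : ℕ) : ℤ) by push_cast; ring,
              hk (i + 2) (by omega) (by omega)] at this
            linarith
        -- sum of |D| over these 2q positions
        have hsub : Finset.Icc (t₀ + 2) (t₀ + 2 * q + 1) ⊆ Finset.Icc t₀ (t₁ + 1) :=
          Finset.Icc_subset_Icc (by omega) (by omega)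
        have hge : (4 * q : ℤ) ≤ ∑ k ∈ Finset.Icc (t₀ + 2) (t₀ + 2 * q + 1), |D k| := by
          have hconst : ∀ k ∈ Finset.Icc (t₀ + 2) (t₀ + 2 * q + 1), (2 : ℤ) ≤ |D k| := by
            intro k hk'
            obtain ⟨hk1, hk2⟩ := Finset.mem_Icc.mp hk'
            have := hD2v (k - (t₀ + 2)).toNat (by omega)
            rw [show t₀ + 2 + ((k - (t₀ + 2)).toNat : ℤ) = k by omega] at this
            rw [this, abs_mul]
            have : (1 : ℤ) ≤ |c t₀| := Int.one_le_abs hv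
            simp only [Nat.abs_ofNat]; linarith
          calc (4 * q : ℤ) = ∑ _k ∈ Finset.Icc (t₀ + 2) (t₀ + 2 * q + 1), (2 : ℤ) := by
                rw [Finset.sum_const, Int.card_Icc, nsmul_eq_mul,
                  show (t₀ + 2 * q + 1 + 1 - (t₀ + 2)).toNat = 2 * q by omega]
                push_cast; ring
            _ ≤ _ := Finset.sum_le_sum hconst
        have := Finset.sum_le_sum_of_subset_of_nonneg hsub (fun k _ _ => abs_nonneg (D k))
        linarith
    · exact ⟨t₀ - 2 * q + 1, le_rfl, by omega, by rw [hb1]; exact sub_ne_zero.mpr hb, fun h => by omega⟩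
  -- TOP SIDE: symmetric
  have htopside : ∃ τ, t₁ - 2 * q ≤ τ ∧ τ ≤ t₁ - 1 ∧ t₀ ≤ τ ∧ coef τ ≠ 0 ∧
      (τ = t₁ - 1 ∨ c (t₁ - 1) = c t₁) := by
    by_cases ht : c (t₁ - 1) = c t₁
    · by_cases hk : ∃ k : ℕ, 2 ≤ k ∧ k ≤ 2 * q ∧ c (t₁ - k) ≠ 0
      · classical
        let k := Nat.find hk
        obtain ⟨hk2, hk2q, hck⟩ := Nat.find_spec hk
        have hmin : ∀ i : ℕ, 2 ≤ i → i < k → c (t₁ - i) = 0 := by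
          intro i hi hik
          by_contra hci
          exact Nat.find_min hk hik ⟨hi, by omega, hci⟩
        have hzero : ∀ i : ℕ, 1 ≤ i → i < k → coef (t₁ - i) = 0 := by
          intro i hi hik
          induction i with
          | zero => omega
          | succ i ih =>
            rcases Nat.eq_zero_or_pos i with h0 | h0
            · subst h0; simp only [zero_add, Nat.cast_one]; rw [ht1, ht, sub_self]
            · have hprev := ih h0 (by omega)
              have h := hrec (t₁ - ((i + 1 : ℕ) : ℤ))
              rw [show t₁ - ((i + 1 : ℕ) : ℤ) + 1 = t₁ - (i : ℤ) by push_cast; ring, hprev, add_zero,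
                if_neg (show ¬ (t₀ ≤ t₁ - ((i + 1 : ℕ) : ℤ) + 2 * q + 1 ∧
                  t₁ - ((i + 1 : ℕ) : ℤ) + 2 * q + 1 ≤ t₁) by omega), add_zero] at h
              rw [h]
              by_cases hr : t₀ ≤ t₁ - ((i + 1 : ℕ) : ℤ) ∧ t₁ - ((i + 1 : ℕ) : ℤ) ≤ t₁
              · rw [if_pos hr]; exact hmin (i + 1) (by omega) hik
              · rw [if_neg hr]
        have hkt : t₀ ≤ t₁ - (k : ℤ) := by
          by_contra hh
          exact hck (hcout _ (Or.inl (by omega)))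
        refine ⟨t₁ - k, by omega, by omega, hkt, ?_, Or.inr ht⟩
        have h := hrec (t₁ - (k : ℤ))
        have hkm1 : coef (t₁ - ((k - 1 : ℕ) : ℤ)) = 0 := hzero (k - 1) (by omega) (by omega)
        rw [show t₁ - (k : ℤ) + 1 = t₁ - ((k - 1 : ℕ) : ℤ) by omega, hkm1, add_zero,
          if_neg (show ¬ (t₀ ≤ t₁ - (k : ℤ) + 2 * q + 1 ∧ t₁ - (k : ℤ) + 2 * q + 1 ≤ t₁) by omega),
          add_zero] at h
        rw [h]
        rw [if_pos ⟨hkt, by omega⟩]; exact hck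
      · exfalso
        push Not at hk
        have hv : c t₁ ≠ 0 := hc1
        have ht0far : t₀ + 2 * q + 1 ≤ t₁ := by
          by_contra hh
          rcases lt_or_ge (t₁ - t₀) 2 with hs | hs
          · have heq : t₁ = t₀ + 1 := by omega
            have h1 := hD t₀; have h2 := hD (t₀ + 1)
            rw [hD0 t₀ le_rfl] at h1
            rw [hD1 (t₀ + 1 + 1) (by omega)] at h2
            rw [heq, show t₀ + 1 - 1 = t₀ by ring] at ht
            rw [heq] at hv
            have : c t₀ + c (t₀ + 1) = 0 := by linarith
            rw [ht] at this; exact hv (by linarith)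
          · have := hk (t₁ - t₀).toNat (by omega) (by omega)
            rw [show t₁ - ((t₁ - t₀).toNat : ℤ) = t₀ by omega] at this
            exact hc0 this
        have hDt : D t₁ = - c t₁ := by have := hD t₁; rw [hD1 (t₁ + 1) (by omega)] at this; linarith
        have hD2v : ∀ i : ℕ, i ≤ 2 * q - 1 → D (t₁ - 1 - i) = -(2 * c t₁) := by
          intro i hi
          induction i with
          | zero =>
            have := hD (t₁ - 1)
            rw [show t₁ - 1 + 1 = t₁ by ring, hDt, ht] at this
            rw [show t₁ - 1 - ((0 : ℕ) : ℤ) = t₁ - 1 by push_cast; ring]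
            linarith
          | succ i ih =>
            have hprev := ih (by omega)
            have := hD (t₁ - 1 - ((i + 1 : ℕ) : ℤ))
            rw [show t₁ - 1 - ((i + 1 : ℕ) : ℤ) + 1 = t₁ - 1 - (i : ℤ) by push_cast; ring, hprev,
              show t₁ - 1 - ((i + 1 : ℕ) : ℤ) = t₁ - ((i + 2 : ℕ) : ℤ) by push_cast; ring,
              hk (i + 2) (by omega) (by omega)] at this
            rw [show t₁ - 1 - ((i + 1 : ℕ) : ℤ) = t₁ - ((i + 2 : ℕ) : ℤ) by push_cast; ring]
            linarith
        have hsub : Finset.Icc (t₁ - 2 * q) (t₁ - 1) ⊆ Finset.Icc t₀ (t₁ + 1) :=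
          Finset.Icc_subset_Icc (by omega) (by omega)
        have hge : (4 * q : ℤ) ≤ ∑ k ∈ Finset.Icc (t₁ - 2 * q) (t₁ - 1), |D k| := by
          have hconst : ∀ k ∈ Finset.Icc (t₁ - 2 * q) (t₁ - 1), (2 : ℤ) ≤ |D k| := by
            intro k hk'
            obtain ⟨hk1, hk2⟩ := Finset.mem_Icc.mp hk'
            have := hD2v (t₁ - 1 - k).toNat (by omega)
            rw [show t₁ - 1 - ((t₁ - 1 - k).toNat : ℤ) = k by omega] at this
            rw [this, abs_neg, abs_mul]
            have : (1 : ℤ) ≤ |c t₁| := Int.one_le_abs hv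
            simp only [Nat.abs_ofNat]; linarith
          calc (4 * q : ℤ) = ∑ _k ∈ Finset.Icc (t₁ - 2 * q) (t₁ - 1), (2 : ℤ) := by
                rw [Finset.sum_const, Int.card_Icc, nsmul_eq_mul,
                  show (t₁ - 1 + 1 - (t₁ - 2 * q)).toNat = 2 * q by omega]
                push_cast; ring
            _ ≤ _ := Finset.sum_le_sum hconst
        have := Finset.sum_le_sum_of_subset_of_nonneg hsub (fun k _ _ => abs_nonneg (D k))
        linarith
    · exact ⟨t₁ - 1, by omega, le_rfl, by omega, by rw [ht1]; exact sub_ne_zero.mpr ht, Or.inl rfl⟩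
  -- assemble four distinct slots
  obtain ⟨τb, hτb1, hτb2, hτb, hτbx⟩ := hbottom
  obtain ⟨τt, hτt1, hτt2, hτt0, hτt, hτt_or⟩ := htopside
  have hne : τb ≠ τt := by
    intro h
    have hb0 : τb = t₀ := by omega
    obtain ⟨hfar, hzeros⟩ := hτbx hb0
    rcases hτt_or with h1 | h1
    · omega
    · -- span = 2q and the bottom zeros kill c (t₁ - 1) = c t₁ ≠ 0
      have hspan : t₁ = t₀ + 2 * q := by omega
      have := hzeros (2 * q - 1) (by omega) (by omega)
      rw [show t₀ + ((2 * q - 1 : ℕ) : ℤ) = t₁ - 1 by omega, h1] at this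
      exact hc1 this
  refine ⟨{t₁, t₀ - 2 * q, τb, τt}, ?_, ?_⟩
  · rw [Finset.card_insert_of_notMem, Finset.card_insert_of_notMem, Finset.card_pair hne]
    · simp only [Finset.mem_insert, Finset.mem_singleton]; omega
    · simp only [Finset.mem_insert, Finset.mem_singleton]; omega
  · intro τ hτ
    simp only [Finset.mem_insert, Finset.mem_singleton] at hτ
    rcases hτ with rfl | rfl | rfl | rfl
    · exact htop'
    · exact hbot'
    · exact hτb
    · exact hτt

end Summit.ValiantsHypothesis.ValiantsHypothesis.Theorems.PeelingLemmaWindow
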